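import Mathlib
import Summits.NavierStokesRegularity.NavierStokesRegularity.Theorems.SubOnsagerCeilingKPPairSlavingStructural
import HarnessLib

/-!
# Closed-form dynamics of the SIDE-BRANCH CLASS of KP networks proper, and the dissipative-range slaving bound
(helper file for crux stmt-NavierStokesRegularity-27057 `SubOnsagerCeiling.ForwardTailCeilingKP`,
`--supports … --as helper`; LEAD SOC census v6 §C, the class of the planned joint-region rung)

THE CLASS (def-free, by coefficient hypotheses on a KP network proper `α`: symmetric, cancelling, orthant,
diagonal feeds): forward feeds `w_{ac} = α a a c (0,0,1)` supported on the chain `0 → 0` (weight `c₀`) and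
the exit `1 → 2` (weight `f`); in-shell pumps `P_{a→c} = α a a c (0,0,0)` supported on `0 → 1` (weight `P`);
no differential in-shell triads (`α a b c (0,0,0) = 0` for pairwise distinct `a, b, c`). This is the
architecture of the 25507 witness `sideBranchTable` (`c₀ = 1`, `P = f = 1/5`) with free weights: a
Katz–Pavlović chain on component `0`, a side source `1` pumped in-shell by the chain and feeding a
DEAD-END pocket `2` one shell up; component `3` is inert.

* `sideClass_quadTerm_chain` — `quadTerm₀(n) = c₀Λ_{n-1}x²_{0,n-1} − c₀Λₙx_{0,n}x_{0,n+1} − PΛₙx_{0,n}x_{1,n}`: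
  the chain with the EXTRA DAMPING `E_n = PΛₙ x_{1,n}` (the shape consumed by `chain_shellBarrier_damped`);
* `sideClass_quadTerm_side` — `quadTerm₁(n) = PΛₙx²_{0,n} − fΛₙx_{1,n}x_{2,n+1}` (the pair-lemma shape,
  `hIn` with `I₀ = PΛₙ·(chain envelope)²`);
* `sideClass_quadTerm_pocket` — `quadTerm₂(n) = fΛ_{n-1}x²_{1,n-1}` (dead end: `hOut` with `ρ₀ = ν-term only`);
* `sideClass_quadTerm_inert` — `quadTerm₃(n) = 0`;
* `linearSlaving_le` — the DISSIPATIVE-RANGE bound: `s' ≤ I₀ − κ s`, `κ > 0`, `s(t₀) ≤ I₀/κ` ⇒ `s ≤ I₀/κ`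
  (where the viscous rate beats the nonlinear envelope rate the pair lemma is not needed).

(`Λₙ = (1+ε₀)^{5n/2}`.) HONEST FRAMING: algebra/ODE comparison about Tao-type MODEL lattice tables (rung
TL-M2Break, route SubOnsagerCeiling); ingredients of a rung, not a proof of the crux; nothing here bears on
Navier–Stokes regularity.
-/

noncomputable section

-- the sub-problem namespace `NavierStokesRegularity.NavierStokesRegularity` is the tree's layout (D-0017)
set_option linter.dupNamespace false

namespace Summit.NavierStokesRegularity.NavierStokesRegularity.Theorems

open Set Finset Filter Topology
open Literature.Analysis.FluidPDE.TaoCascade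

section SideClass

variable {α : Fin 4 → Fin 4 → Fin 4 → ℤ × ℤ × ℤ → ℝ} {c₀ P f : ℝ}

/-- In the side-branch class every in-shell coefficient `α a b i (0,0,0)` is explicit: the pump weight
`P` at `(a,b,i) = (0,0,1)`, its back-reaction `−P/2` at `(0,1,0)` and `(1,0,0)`, and `0` elsewhere.
[this file] -/
theorem sideClass_coeff (hs : IsSymmetricCoeff α) (hc : IsCancellingCoeff α)
    (hP : ∀ a c : Fin 4, a ≠ c → α a a c (0, 0, 0) = if a = 0 ∧ c = 1 then P else 0)
    (hCz : ∀ a b c : Fin 4, a ≠ b → a ≠ c → b ≠ c → α a b c (0, 0, 0) = 0) (a b i : Fin 4) :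
    α a b i (0, 0, 0) =
      (if a = 0 ∧ b = 0 ∧ i = 1 then P else 0) +
        (if (a = 0 ∧ b = 1 ∧ i = 0) ∨ (a = 1 ∧ b = 0 ∧ i = 0) then -P / 2 else 0) := by
  have hdiag : ∀ e : Fin 4, α e e e (0, 0, 0) = 0 := fun e => kpProper_inShell_diag_zero hc e
  have hback : ∀ e j : Fin 4, e ≠ j → α e j e (0, 0, 0) = -(α e e j (0, 0, 0)) / 2 := by
    intro e j hej
    have h1 := kpProper_inShell_back hc e j
    have h2 : α j e e (0, 0, 0) = α e j e (0, 0, 0) := hs j e e 0 0 0 kpProper_mem000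
    linarith
  have hback' : ∀ e j : Fin 4, e ≠ j → α j e e (0, 0, 0) = -(α e e j (0, 0, 0)) / 2 := by
    intro e j hej
    rw [hs j e e 0 0 0 kpProper_mem000, hback e j hej]
  fin_cases a <;> fin_cases b <;> fin_cases i <;>
    first
      | (rw [hdiag]; norm_num)
      | (rw [hCz _ _ _ (by decide) (by decide) (by decide)]; norm_num)
      | (rw [hP _ _ (by decide)]; norm_num)
      | (rw [hback _ _ (by decide), hP _ _ (by decide)]; norm_num)
      | (rw [hback' _ _ (by decide), hP _ _ (by decide)]; norm_num)

/-- Closed form of the in-shell sum into component `i` in the side-branch class: the pump `P x₀²` into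
component `1` and its back-reaction `−P x₀ x₁` on component `0`. [this file] -/
theorem sideClass_inShell (hs : IsSymmetricCoeff α) (hc : IsCancellingCoeff α)
    (hP : ∀ a c : Fin 4, a ≠ c → α a a c (0, 0, 0) = if a = 0 ∧ c = 1 then P else 0)
    (hCz : ∀ a b c : Fin 4, a ≠ b → a ≠ c → b ≠ c → α a b c (0, 0, 0) = 0)
    (y : Fin 4 → ℝ) (i : Fin 4) :
    ∑ a, ∑ b, α a b i (0, 0, 0) * (y a * y b) =
      (if i = 1 then P * (y 0 * y 0) else 0) - (if i = 0 then P * (y 0 * y 1) else 0) := by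
  fin_cases i
  all_goals simp (config := { decide := true }) [Fin.sum_univ_four, sideClass_coeff hs hc hP hCz]
  ring

/-- **Chain component**: `quadTerm₀(n) = c₀Λ_{n-1}x²_{0,n-1} − c₀Λₙx_{0,n}x_{0,n+1} − PΛₙx_{0,n}x_{1,n}`.
[this file] -/
theorem sideClass_quadTerm_chain (hs : IsSymmetricCoeff α) (hc : IsCancellingCoeff α)
    (hO : ∀ (Y : Fin 4 → ℤ → ℝ → ℝ) (τ : ℝ), (∀ (j : Fin 4) (k : ℤ), 1 ≤ k → 0 ≤ Y j k τ) →
      ∀ δ : ℝ, 0 < δ → ∀ (i : Fin 4) (n : ℤ), 1 ≤ n → Y i n τ = 0 → 0 ≤ quadTerm δ α Y i n τ)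
    (hD : ∀ a b i : Fin 4, a ≠ b → α a b i (0, 0, 1) = 0)
    (hw : ∀ a c : Fin 4, α a a c (0, 0, 1) = (if a = 0 ∧ c = 0 then c₀ else 0) + (if a = 1 ∧ c = 2 then f else 0))
    (hP : ∀ a c : Fin 4, a ≠ c → α a a c (0, 0, 0) = if a = 0 ∧ c = 1 then P else 0)
    (hCz : ∀ a b c : Fin 4, a ≠ b → a ≠ c → b ≠ c → α a b c (0, 0, 0) = 0)
    (ε₀ : ℝ) (X : Fin 4 → ℤ → ℝ → ℝ) (n : ℤ) (t : ℝ) :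
    quadTerm ε₀ α X 0 n t =
      c₀ * (1 + ε₀) ^ ((5 : ℝ) * ((n : ℝ) - 1) / 2) * X 0 (n - 1) t ^ 2 -
        c₀ * (1 + ε₀) ^ ((5 : ℝ) * n / 2) * (X 0 n t * X 0 (n + 1) t) -
        P * (1 + ε₀) ^ ((5 : ℝ) * n / 2) * (X 0 n t * X 1 n t) := by
  rw [kpProper_quadTerm hs hc hO hD, sideClass_inShell hs hc hP hCz (fun j => X j n t) 0]
  simp [hw]
  ring

/-- **Side source**: `quadTerm₁(n) = PΛₙx²_{0,n} − fΛₙx_{1,n}x_{2,n+1}`. [this file] -/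
theorem sideClass_quadTerm_side (hs : IsSymmetricCoeff α) (hc : IsCancellingCoeff α)
    (hO : ∀ (Y : Fin 4 → ℤ → ℝ → ℝ) (τ : ℝ), (∀ (j : Fin 4) (k : ℤ), 1 ≤ k → 0 ≤ Y j k τ) →
      ∀ δ : ℝ, 0 < δ → ∀ (i : Fin 4) (n : ℤ), 1 ≤ n → Y i n τ = 0 → 0 ≤ quadTerm δ α Y i n τ)
    (hD : ∀ a b i : Fin 4, a ≠ b → α a b i (0, 0, 1) = 0)
    (hw : ∀ a c : Fin 4, α a a c (0, 0, 1) = (if a = 0 ∧ c = 0 then c₀ else 0) + (if a = 1 ∧ c = 2 then f else 0))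
    (hP : ∀ a c : Fin 4, a ≠ c → α a a c (0, 0, 0) = if a = 0 ∧ c = 1 then P else 0)
    (hCz : ∀ a b c : Fin 4, a ≠ b → a ≠ c → b ≠ c → α a b c (0, 0, 0) = 0)
    (ε₀ : ℝ) (X : Fin 4 → ℤ → ℝ → ℝ) (n : ℤ) (t : ℝ) :
    quadTerm ε₀ α X 1 n t =
      P * (1 + ε₀) ^ ((5 : ℝ) * n / 2) * (X 0 n t * X 0 n t) -
        f * (1 + ε₀) ^ ((5 : ℝ) * n / 2) * (X 1 n t * X 2 (n + 1) t) := by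
  rw [kpProper_quadTerm hs hc hO hD, sideClass_inShell hs hc hP hCz (fun j => X j n t) 1]
  simp [hw]
  ring

/-- **Dead-end pocket**: `quadTerm₂(n) = fΛ_{n-1}x²_{1,n-1}`. [this file] -/
theorem sideClass_quadTerm_pocket (hs : IsSymmetricCoeff α) (hc : IsCancellingCoeff α)
    (hO : ∀ (Y : Fin 4 → ℤ → ℝ → ℝ) (τ : ℝ), (∀ (j : Fin 4) (k : ℤ), 1 ≤ k → 0 ≤ Y j k τ) →
      ∀ δ : ℝ, 0 < δ → ∀ (i : Fin 4) (n : ℤ), 1 ≤ n → Y i n τ = 0 → 0 ≤ quadTerm δ α Y i n τ)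
    (hD : ∀ a b i : Fin 4, a ≠ b → α a b i (0, 0, 1) = 0)
    (hw : ∀ a c : Fin 4, α a a c (0, 0, 1) = (if a = 0 ∧ c = 0 then c₀ else 0) + (if a = 1 ∧ c = 2 then f else 0))
    (hP : ∀ a c : Fin 4, a ≠ c → α a a c (0, 0, 0) = if a = 0 ∧ c = 1 then P else 0)
    (hCz : ∀ a b c : Fin 4, a ≠ b → a ≠ c → b ≠ c → α a b c (0, 0, 0) = 0)
    (ε₀ : ℝ) (X : Fin 4 → ℤ → ℝ → ℝ) (n : ℤ) (t : ℝ) :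
    quadTerm ε₀ α X 2 n t = f * (1 + ε₀) ^ ((5 : ℝ) * ((n : ℝ) - 1) / 2) * X 1 (n - 1) t ^ 2 := by
  rw [kpProper_quadTerm hs hc hO hD, sideClass_inShell hs hc hP hCz (fun j => X j n t) 2]
  simp [hw]
  ring

/-- **Inert component**: `quadTerm₃(n) = 0`. [this file] -/
theorem sideClass_quadTerm_inert (hs : IsSymmetricCoeff α) (hc : IsCancellingCoeff α)
    (hO : ∀ (Y : Fin 4 → ℤ → ℝ → ℝ) (τ : ℝ), (∀ (j : Fin 4) (k : ℤ), 1 ≤ k → 0 ≤ Y j k τ) →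
      ∀ δ : ℝ, 0 < δ → ∀ (i : Fin 4) (n : ℤ), 1 ≤ n → Y i n τ = 0 → 0 ≤ quadTerm δ α Y i n τ)
    (hD : ∀ a b i : Fin 4, a ≠ b → α a b i (0, 0, 1) = 0)
    (hw : ∀ a c : Fin 4, α a a c (0, 0, 1) = (if a = 0 ∧ c = 0 then c₀ else 0) + (if a = 1 ∧ c = 2 then f else 0))
    (hP : ∀ a c : Fin 4, a ≠ c → α a a c (0, 0, 0) = if a = 0 ∧ c = 1 then P else 0)
    (hCz : ∀ a b c : Fin 4, a ≠ b → a ≠ c → b ≠ c → α a b c (0, 0, 0) = 0)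
    (ε₀ : ℝ) (X : Fin 4 → ℤ → ℝ → ℝ) (n : ℤ) (t : ℝ) :
    quadTerm ε₀ α X 3 n t = 0 := by
  rw [kpProper_quadTerm hs hc hO hD, sideClass_inShell hs hc hP hCz (fun j => X j n t) 3]
  simp [hw]

end SideClass

/-! ## The dissipative-range slaving bound -/

/-- **Linear slaving** (dissipative range): if `s' ≤ I₀ − κ s` on `[t₀, t₁]` with `κ > 0` and
`s(t₀) ≤ I₀/κ`, then `s ≤ I₀/κ` on `[t₀, t₁]` (1-D invariant region; first-hitting time + left slopes).
[folklore ODE comparison; this file] -/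
theorem linearSlaving_le {s s' : ℝ → ℝ} {t₀ t₁ I₀ κ : ℝ} (hκ : 0 < κ)
    (hsd : ∀ t ∈ Icc t₀ t₁, HasDerivWithinAt s (s' t) (Icc t₀ t₁) t)
    (hs' : ∀ t ∈ Icc t₀ t₁, s' t ≤ I₀ - κ * s t) (hinit : s t₀ ≤ I₀ / κ) :
    ∀ t ∈ Icc t₀ t₁, s t ≤ I₀ / κ := by
  -- it suffices to prove `s < I₀/κ + ε` for every `ε > 0`
  suffices key : ∀ ε : ℝ, 0 < ε → ∀ t ∈ Icc t₀ t₁, s t < I₀ / κ + ε by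
    intro t ht
    by_contra h
    push Not at h
    have := key ((s t - I₀ / κ) / 2) (by linarith) t ht
    linarith
  intro ε hε
  have hscont : ContinuousOn s (Icc t₀ t₁) := fun t ht => (hsd t ht).continuousWithinAt
  set S : ℝ := I₀ / κ + ε with hS
  by_contra hcon
  push Not at hcon
  obtain ⟨tb, htb, hStb⟩ := hcon
  set A : Set ℝ := Icc t₀ t₁ ∩ s ⁻¹' (Ici S) with hA
  have hAc : IsClosed A := hscont.preimage_isClosed_of_isClosed isClosed_Icc isClosed_Ici
  have hAne : A.Nonempty := ⟨tb, htb, hStb⟩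
  have hAbdd : BddBelow A := ⟨t₀, fun t ht => ht.1.1⟩
  set t₂ := sInf A with ht₂
  have ht₂A : t₂ ∈ A := hAc.csInf_mem hAne hAbdd
  have ht₂I : t₂ ∈ Icc t₀ t₁ := ht₂A.1
  have hSle : S ≤ s t₂ := ht₂A.2
  have hbefore : ∀ t ∈ Icc t₀ t₁, t < t₂ → s t < S := by
    intro t ht hlt
    by_contra h
    push Not at h
    have : t₂ ≤ t := csInf_le hAbdd ⟨ht, h⟩
    linarith
  have ht₀₂ : t₀ < t₂ := by
    rcases eq_or_lt_of_le ht₂I.1 with h | h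
    · rw [← h] at hSle; rw [hS] at hSle; linarith
    · exact h
  -- at `t₂` the derivative is negative …
  have hneg : s' t₂ < 0 := by
    have h := hs' t₂ ht₂I
    have : κ * S ≤ κ * s t₂ := mul_le_mul_of_nonneg_left hSle hκ.le
    have hκS : κ * S = I₀ + κ * ε := by rw [hS]; field_simp
    nlinarith
  -- … but `s` approaches `S` from below
  have hder : HasDerivWithinAt s (s' t₂) (Ico t₀ t₂) t₂ :=
    (hsd t₂ ht₂I).mono fun u hu => ⟨hu.1, hu.2.le.trans ht₂I.2⟩
  rw [hasDerivWithinAt_iff_tendsto_slope' (by simp)] at hder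
  have hev : ∀ᶠ u in 𝓝[Ico t₀ t₂] t₂, slope s t₂ u < 0 := hder.eventually_lt_const hneg
  have hne : (𝓝[Ico t₀ t₂] t₂).NeBot := by
    refine mem_closure_iff_nhdsWithin_neBot.1 ?_
    rw [closure_Ico ht₀₂.ne]
    exact right_mem_Icc.2 ht₀₂.le
  obtain ⟨u, hu, huI⟩ := (hev.and self_mem_nhdsWithin).exists
  have hult : u < t₂ := huI.2
  rw [slope_def_field] at hu
  have hsu : s u < S := hbefore u ⟨huI.1, hult.le.trans ht₂I.2⟩ hult
  have hnum : 0 < s u - s t₂ := by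
    have hden : u - t₂ < 0 := by linarith
    by_contra hh
    push Not at hh
    have : 0 ≤ (s u - s t₂) / (u - t₂) := div_nonneg_of_nonpos hh hden.le
    linarith
  linarith

end Summit.NavierStokesRegularity.NavierStokesRegularity.Theorems

end
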